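import Mathlib.Tactic.Module
import Summits.KontsevichZagierPeriods.KontsevichZagierPeriods.Theses.HeckeMultiplicityOne
import Literature.NumberTheory.Transcendental.KZRelationsLE
import Literature.NumberTheory.Transcendental.KZSubcalculusInvariants

/-!
# Line `t2-traces` for the crux `DeltaRatioHecke` (stmt-KontsevichZagierPeriods-4688, route HeckeMultiplicityOne)

REGISTERED SKELETON (crux-strategist, 2026-08-17). Idea: Manin's own seam — the Hecke correspondence
`T₂` gives LINEAR TRACE IDENTITIES among KZ's eleven Legendre representations `R(k)` of
`2⁸π¹¹L*(Δ,s)` (`s = 11 − k`); the identity on `L*(Δ,1)` carries the prime `691` through the Hecke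
projector `1049 + 1024 = 2073 = σ₁₁(2) − τ(2) = 3·691`, the identity on `L*(Δ,5)` fixes the middle
ratio, the Fricke reflection folds `R(k) ~ R(10−k)`, and integer division by `3` (torsion-freeness of
`FormalRep ⧸ relations`, re-derived below from `KZ.scale`) finishes. Exact check: the 22 real
`T₂`-relations have rank 9 on `ℝ¹¹` and their null space is Manin's table (planner `num/`).

Stubs (each the text of a CHILD ITEM of the split filed on the route; sorries only here):
* `stub_heckeTrace`   — `LegendreHeckeTrace`: `1049[R₁] + 180[R₃] − 3360[R₅] + 13440[R₇] − 11520[R₉] + 1024[R₁₁] ∈ relations`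
  (the `T₂` trace on `∫₀^{i∞}Δ dτ`: Landen `τ ↦ 2τ, τ/2` as rule-2 moves on the cube + the cusp `1/2`
  by Cauchy on `(0, 1/2, i∞)` and `γ = (1 0; 2 1)`; HARDEST);
* `stub_middleTrace`  — `LegendreMiddleTrace`: `9[R₃] − 30[R₅] + 16[R₇] ∈ relations` (the `T₂` trace on
  `∫₀^{i∞}Δ τ⁴ dτ`; ≡ `DeltaRatioStokes` modulo the reflection: `DeltaRatioStokes_of`,
  `stub_middleTrace_of_deltaRatioStokes` below);
* `stub_reflection`   — `LegendreReflection`: `R(k) ~ R(10−k)` for `k ≤ 10` (rule 2; provable now after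
  `deltaFunctionalEquation_proof`, `k = 8`);
* `stub_repExists`    — `LegendreRepExists`: the Legendre representations exist (integrability; provable now).
Composition `DeltaRatioHecke_of : stub texts → DeltaRatioHecke` is kernel-checked (no sorry), and
concludes the route decl BY NAME.

Sources: Manin 1973 §§7–9; Kontsevich–Zagier 2001 §1.2, §3.4; Paşol–Popa arXiv:1202.5802 §5.
-/

noncomputable section

namespace Summit.KontsevichZagierPeriods.KontsevichZagierPeriods.Cruxes.DeltaRatioHecke.T2Traces

open Set MeasureTheory
open Literature.NumberTheory.Transcendental
open Literature.NumberTheory.Transcendental.KZ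

/-! ### Registered stubs -/

/-- STUB (child item `LegendreHeckeTrace`, crux, HARDEST): the `T₂` trace identity on `L*(Δ,1)`.
[cite: Manin1973, §§7–9] -/
theorem stub_heckeTrace :
    ∀ (r₁ r₃ r₅ r₇ r₉ r₁₁ : Literature.NumberTheory.Transcendental.KZ.IntegralRep 11), r₁.domain = {v | ∀ i, v i ∈ Set.Ioo (0:ℝ) 1} → Set.EqOn r₁.integrand (fun v => v 0 * (1 - v 0) * ∏ i : Fin 10, 1 / Real.sqrt (v i.succ * (1 - v i.succ) * (1 - v 0 * v i.succ))) r₁.domain → r₃.domain = {v | ∀ i, v i ∈ Set.Ioo (0:ℝ) 1} → Set.EqOn r₃.integrand (fun v => v 0 * (1 - v 0) * ∏ i : Fin 10, 1 / Real.sqrt (v i.succ * (1 - v i.succ) * (1 - (if (i : ℕ) < 8 then v 0 else 1 - v 0) * v i.succ))) r₃.domain → r₅.domain = {v | ∀ i, v i ∈ Set.Ioo (0:ℝ) 1} → Set.EqOn r₅.integrand (fun v => v 0 * (1 - v 0) * ∏ i : Fin 10, 1 / Real.sqrt (v i.succ * (1 - v i.succ) * (1 - (if (i : ℕ) < 6 then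 v 0 else 1 - v 0) * v i.succ))) r₅.domain → r₇.domain = {v | ∀ i, v i ∈ Set.Ioo (0:ℝ) 1} → Set.EqOn r₇.integrand (fun v => v 0 * (1 - v 0) * ∏ i : Fin 10, 1 / Real.sqrt (v i.succ * (1 - v i.succ) * (1 - (if (i : ℕ) < 4 then v 0 else 1 - v 0) * v i.succ))) r₇.domain → r₉.domain = {v | ∀ i, v i ∈ Set.Ioo (0:ℝ) 1} → Set.EqOn r₉.integrand (fun v => v 0 * (1 - v 0) * ∏ i : Fin 10, 1 / Real.sqrt (v i.succ * (1 - v i.succ) * (1 - (if (i : ℕ) < 2 then v 0 else 1 - v 0) * v i.succ))) r₉.domain → r₁₁.domain = {v | ∀ i, v i ∈ Set.Ioo (0:ℝ) 1} → Set.EqOn r₁₁.integrand (fun v => v 0 * (1 - v 0) * ∏ i : Fin 10, 1 / Real.sqrt (v i.succ * (1 - v i.succ) * (1 - (if (i : ℕ) < 0 then v 0 else 1 - v 0) * v i.succ))) r₁₁.domain → (1049 : ℤ) • Literature.NumberTheory.Transcendental.KZ.of r₁ + (180 : ℤ) • Literature.NumberTheory.Transcendental.KZ.of r₃ - (3360 :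 ℤ) • Literature.NumberTheory.Transcendental.KZ.of r₅ + (13440 : ℤ) • Literature.NumberTheory.Transcendental.KZ.of r₇ - (11520 : ℤ) • Literature.NumberTheory.Transcendental.KZ.of r₉ + (1024 : ℤ) • Literature.NumberTheory.Transcendental.KZ.of r₁₁ ∈ Literature.NumberTheory.Transcendental.KZ.relations := by
  sorry

/-- STUB (child item `LegendreMiddleTrace`, crux): the `T₂` trace identity on `L*(Δ,5)`.
[cite: Manin1973, §§7–9] -/
theorem stub_middleTrace :
    ∀ (r₃ r₅ r₇ : Literature.NumberTheory.Transcendental.KZ.IntegralRep 11), r₃.domain = {v | ∀ i, v i ∈ Set.Ioo (0:ℝ) 1} → Set.EqOn r₃.integrand (fun v => v 0 * (1 - v 0) * ∏ i : Fin 10, 1 / Real.sqrt (v i.succ * (1 - v i.succ) * (1 - (if (i : ℕ) < 8 then v 0 else 1 - v 0) * v i.succ))) r₃.domain → r₅.domain = {v | ∀ i, v i ∈ Set.Ioo (0:ℝ) 1} → Set.EqOn r₅.integrand (fun v => v 0 * (1 - v 0) * ∏ i : Fin 10, 1 / Real.sqrt (v i.succ * (1 - v i.succ) * (1 - (if (i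 : ℕ) < 6 then v 0 else 1 - v 0) * v i.succ))) r₅.domain → r₇.domain = {v | ∀ i, v i ∈ Set.Ioo (0:ℝ) 1} → Set.EqOn r₇.integrand (fun v => v 0 * (1 - v 0) * ∏ i : Fin 10, 1 / Real.sqrt (v i.succ * (1 - v i.succ) * (1 - (if (i : ℕ) < 4 then v 0 else 1 - v 0) * v i.succ))) r₇.domain → (9 : ℤ) • Literature.NumberTheory.Transcendental.KZ.of r₃ - (30 : ℤ) • Literature.NumberTheory.Transcendental.KZ.of r₅ + (16 : ℤ) • Literature.NumberTheory.Transcendental.KZ.of r₇ ∈ Literature.NumberTheory.Transcendental.KZ.relations := by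
  sorry

/-- STUB (child item `LegendreReflection`, support, provable now): Fricke reflection `R(k) ~ R(10−k)`.
[cite: KontsevichZagier2001, §1.2 rule (2)] -/
theorem stub_reflection :
    ∀ (k : ℕ), k ≤ 10 → ∀ (r r' : Literature.NumberTheory.Transcendental.KZ.IntegralRep 11), r.domain = {v | ∀ i, v i ∈ Set.Ioo (0:ℝ) 1} → Set.EqOn r.integrand (fun v => v 0 * (1 - v 0) * ∏ i : Fin 10, 1 / Real.sqrt (v i.succ * (1 - v i.succ) * (1 - (if (i : ℕ) < k then v 0 else 1 - v 0) * v i.succ))) r.domain → r'.domain = {v | ∀ i, v i ∈ Set.Ioo (0:ℝ) 1} → Set.EqOn r'.integrand (fun v => v 0 * (1 - v 0) * ∏ i : Fin 10, 1 / Real.sqrt (v i.succ * (1 - v i.succ) * (1 - (if (i : ℕ) < 10 - k then v 0 else 1 - v 0) * v i.succ))) r'.domain → Literature.NumberTheory.Transcendental.KZ.Equivalent r r' := by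
  sorry

/-- STUB (child item `LegendreRepExists`, support, provable now): the Legendre representations exist.
[cite: KontsevichZagier2001, §1.1] -/
theorem stub_repExists :
    ∀ (k : ℕ), k ≤ 10 → ∃ r : Literature.NumberTheory.Transcendental.KZ.IntegralRep 11, r.domain = {v | ∀ i, v i ∈ Set.Ioo (0:ℝ) 1} ∧ Set.EqOn r.integrand (fun v => v 0 * (1 - v 0) * ∏ i : Fin 10, 1 / Real.sqrt (v i.succ * (1 - v i.succ) * (1 - (if (i : ℕ) < k then v 0 else 1 - v 0) * v i.succ))) r.domain := by
  sorry

/-! ### Torsion: division by a non-zero integer is admissible modulo the moves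

Re-derivation (cf. `MzvKernelInKZ.Negative.mem_relations_of_nsmul_mem`,
`HeckeMultiplicityOne.torsionFree_proof`, both in modules importing route files) from the scaling
endomorphisms `KZ.scale` of `KZRelationsLE.lean`. -/

section Torsion

variable {n : ℕ}

/-- The algebraic constant `1/k`. [folklore] -/
theorem isAlgebraic_inv_nat (k : ℕ) : IsAlgebraic ℚ ((k : ℝ)⁻¹) :=
  IsAlgebraic.inv_iff.mpr (isAlgebraic_nat k)

/-- Scaling by `k` after scaling by `1/k` gives back the representation (`k ≠ 0`). [folklore] -/
theorem constMul_constMul_inv (r : IntegralRep n) {k : ℕ} (hk : k ≠ 0) :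
    (r.constMul ((k : ℝ)⁻¹) (isAlgebraic_inv_nat k)).constMul (k : ℝ) (isAlgebraic_nat k) = r := by
  have hk' : (k : ℝ) ≠ 0 := Nat.cast_ne_zero.mpr hk
  rcases r with ⟨σ, f, h₁, h₂, h₃⟩
  simp only [IntegralRep.constMul, IntegralRep.mk.injEq, true_and]
  funext x
  rw [← mul_assoc, mul_inv_cancel₀ hk', one_mul]

/-- Generatorwise: `[σ, f] − k • [σ, f/k]` is a relation (integrand additivity,
`KZ.IntegralRep.of_constMul_nat_sub_nsmul_mem_relations`). [cite: KontsevichZagier2001, §1.2 rule (1)] -/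
theorem of_sub_nsmul_of_constMul_inv_mem_relations (r : IntegralRep n) {k : ℕ} (hk : k ≠ 0) :
    of r - k • of (r.constMul ((k : ℝ)⁻¹) (isAlgebraic_inv_nat k)) ∈ relations := by
  have h := IntegralRep.of_constMul_nat_sub_nsmul_mem_relations
    (r.constMul ((k : ℝ)⁻¹) (isAlgebraic_inv_nat k)) k
  rwa [constMul_constMul_inv r hk] at h

/-- Every formal combination `c` is congruent to `k • scale (1/k) c` modulo relations.
[cite: KontsevichZagier2001, §1.2 rule (1)] -/
theorem sub_nsmul_scale_inv_mem_relations {k : ℕ} (hk : k ≠ 0) (c : FormalRep) :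
    c - k • scale ((k : ℝ)⁻¹) (isAlgebraic_inv_nat k) c ∈ relations := by
  induction c using FreeAbelianGroup.induction_on with
  | zero => simp
  | of x =>
    obtain ⟨n, r⟩ := x
    change of r - k • scale ((k : ℝ)⁻¹) (isAlgebraic_inv_nat k) (of r) ∈ relations
    rw [scale_of]
    exact of_sub_nsmul_of_constMul_inv_mem_relations r hk
  | neg x hx =>
    obtain ⟨n, r⟩ := x
    change -of r - k • scale ((k : ℝ)⁻¹) (isAlgebraic_inv_nat k) (-of r) ∈ relations
    have : -of r - k • scale ((k : ℝ)⁻¹) (isAlgebraic_inv_nat k) (-of r) =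
        -(of r - k • scale ((k : ℝ)⁻¹) (isAlgebraic_inv_nat k) (of r)) := by
      rw [map_neg, smul_neg]; abel
    rw [this]
    exact relations.neg_mem hx
  | add x y hx hy =>
    have : x + y - k • scale ((k : ℝ)⁻¹) (isAlgebraic_inv_nat k) (x + y) =
        (x - k • scale ((k : ℝ)⁻¹) (isAlgebraic_inv_nat k) x) +
        (y - k • scale ((k : ℝ)⁻¹) (isAlgebraic_inv_nat k) y) := by
      rw [map_add, smul_add]; abel
    rw [this]
    exact relations.add_mem hx hy

/-- **`FormalRep ⧸ relations` has no `k`-torsion** (`k ≠ 0` natural): `k • c ∈ relations → c ∈ relations`.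
[cite: KontsevichZagier2001, §1.2] -/
theorem mem_relations_of_nsmul_mem {k : ℕ} (hk : k ≠ 0) {c : FormalRep}
    (h : k • c ∈ relations) : c ∈ relations := by
  have h1 := sub_nsmul_scale_inv_mem_relations hk c
  have h2 : k • scale ((k : ℝ)⁻¹) (isAlgebraic_inv_nat k) c ∈ relations := by
    rw [← map_nsmul]
    exact scale_mem_relations _ _ h
  simpa using relations.add_mem h1 h2

/-- **Integer division is admissible**: `k ≠ 0`, `k • c ∈ relations → c ∈ relations` (`k : ℤ`).
[cite: KontsevichZagier2001, §1.2] -/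
theorem mem_relations_of_zsmul_mem {k : ℤ} (hk : k ≠ 0) {c : FormalRep}
    (h : k • c ∈ relations) : c ∈ relations := by
  have hk0 : k.natAbs ≠ 0 := by simpa using hk
  rcases Int.natAbs_eq k with hk' | hk'
  · rw [hk', natCast_zsmul] at h
    exact mem_relations_of_nsmul_mem hk0 h
  · rw [hk', neg_smul, natCast_zsmul] at h
    exact mem_relations_of_nsmul_mem hk0 (relations.neg_mem_iff.mp h)

end Torsion

/-! ### Bookkeeping on the Legendre patterns -/

/-- Transport of an `EqOn` hypothesis between two parameter patterns `c, c' : ℝ¹¹ → Fin 10 → ℝ`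
of the Legendre integrand that agree pointwise (used for `c_i = t` versus `if i < 10 then t else 1 − t`,
and `if i < 2 …` versus `if i < 10 − 8 …`). [folklore] -/
theorem eqOn_legendre_congr {f : (Fin 11 → ℝ) → ℝ} {s : Set (Fin 11 → ℝ)}
    {c c' : (Fin 11 → ℝ) → Fin 10 → ℝ} (h : ∀ v i, c v i = c' v i)
    (hf : Set.EqOn f (fun v => v 0 * (1 - v 0) *
      ∏ i : Fin 10, 1 / Real.sqrt (v i.succ * (1 - v i.succ) * (1 - c v i * v i.succ))) s) :
    Set.EqOn f (fun v => v 0 * (1 - v 0) *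
      ∏ i : Fin 10, 1 / Real.sqrt (v i.succ * (1 - v i.succ) * (1 - c' v i * v i.succ))) s := by
  have e : (fun v : Fin 11 → ℝ => v 0 * (1 - v 0) *
        ∏ i : Fin 10, 1 / Real.sqrt (v i.succ * (1 - v i.succ) * (1 - c v i * v i.succ))) =
      fun v => v 0 * (1 - v 0) *
        ∏ i : Fin 10, 1 / Real.sqrt (v i.succ * (1 - v i.succ) * (1 - c' v i * v i.succ)) := by
    funext v
    simp only [h]
  rwa [e] at hf

/-! ### The assembly -/

/-- **Glue: `DeltaRatioHecke` from its four pieces** —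
`LegendreHeckeTrace → LegendreMiddleTrace → LegendreReflection → LegendreRepExists → DeltaRatioHecke`,
all five texts verbatim (the route file renders
`theorem DeltaRatioHeckeGlueBy_holds : … := deltaRatioHecke_of_pieces`). Proof: instantiate the trace
identities at `R₁, R₃` and at representations `R₅, R₇, R₉, R₁₁` supplied by `LegendreRepExists`, fold
them with the three reflections:
`3·(691[R₁] − 1620[R₃]) = ρ₁ + 720ρ₂ + 1024([R₁]−[R₁₁]) − 11520([R₃]−[R₉]) + 24960([R₅]−[R₇])`
— the Hecke projector, `1049 + 1024 = 2073 = 3·691` — and divide by `3`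
(`mem_relations_of_zsmul_mem`). [cite: Manin1973, §§7–9] [cite: KontsevichZagier2001, §3.4] -/
theorem DeltaRatioHecke_of :
    (∀ (r₁ r₃ r₅ r₇ r₉ r₁₁ : Literature.NumberTheory.Transcendental.KZ.IntegralRep 11), r₁.domain = {v | ∀ i, v i ∈ Set.Ioo (0:ℝ) 1} → Set.EqOn r₁.integrand (fun v => v 0 * (1 - v 0) * ∏ i : Fin 10, 1 / Real.sqrt (v i.succ * (1 - v i.succ) * (1 - v 0 * v i.succ))) r₁.domain → r₃.domain = {v | ∀ i, v i ∈ Set.Ioo (0:ℝ) 1} → Set.EqOn r₃.integrand (fun v => v 0 * (1 - v 0) * ∏ i : Fin 10, 1 / Real.sqrt (v i.succ * (1 - v i.succ) * (1 - (if (i : ℕ) < 8 then v 0 else 1 - v 0) * v i.succ))) r₃.domain → r₅.domain = {v | ∀ i, v i ∈ Set.Ioo (0:ℝ) 1} → Set.EqOn r₅.integrand (fun v => v 0 * (1 - v 0) * ∏ i : Fin 10, 1 / Real.sqrt (v i.succ * (1 - v i.succ) * (1 - (if (i : ℕ) < 6 then v 0 else 1 - v 0) * v i.succ))) r₅.domain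 → r₇.domain = {v | ∀ i, v i ∈ Set.Ioo (0:ℝ) 1} → Set.EqOn r₇.integrand (fun v => v 0 * (1 - v 0) * ∏ i : Fin 10, 1 / Real.sqrt (v i.succ * (1 - v i.succ) * (1 - (if (i : ℕ) < 4 then v 0 else 1 - v 0) * v i.succ))) r₇.domain → r₉.domain = {v | ∀ i, v i ∈ Set.Ioo (0:ℝ) 1} → Set.EqOn r₉.integrand (fun v => v 0 * (1 - v 0) * ∏ i : Fin 10, 1 / Real.sqrt (v i.succ * (1 - v i.succ) * (1 - (if (i : ℕ) < 2 then v 0 else 1 - v 0) * v i.succ))) r₉.domain → r₁₁.domain = {v | ∀ i, v i ∈ Set.Ioo (0:ℝ) 1} → Set.EqOn r₁₁.integrand (fun v => v 0 * (1 - v 0) * ∏ i : Fin 10, 1 / Real.sqrt (v i.succ * (1 - v i.succ) * (1 - (if (i : ℕ) < 0 then v 0 else 1 - v 0) * v i.succ))) r₁₁.domain → (1049 : ℤ) • Literature.NumberTheory.Transcendental.KZ.of r₁ + (180 : ℤ) • Literature.NumberTheory.Transcendental.KZ.of r₃ - (3360 : ℤ) • Literature.NumberTheory.Transcendental.KZ.of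 r₅ + (13440 : ℤ) • Literature.NumberTheory.Transcendental.KZ.of r₇ - (11520 : ℤ) • Literature.NumberTheory.Transcendental.KZ.of r₉ + (1024 : ℤ) • Literature.NumberTheory.Transcendental.KZ.of r₁₁ ∈ Literature.NumberTheory.Transcendental.KZ.relations) →
    (∀ (r₃ r₅ r₇ : Literature.NumberTheory.Transcendental.KZ.IntegralRep 11), r₃.domain = {v | ∀ i, v i ∈ Set.Ioo (0:ℝ) 1} → Set.EqOn r₃.integrand (fun v => v 0 * (1 - v 0) * ∏ i : Fin 10, 1 / Real.sqrt (v i.succ * (1 - v i.succ) * (1 - (if (i : ℕ) < 8 then v 0 else 1 - v 0) * v i.succ))) r₃.domain → r₅.domain = {v | ∀ i, v i ∈ Set.Ioo (0:ℝ) 1} → Set.EqOn r₅.integrand (fun v => v 0 * (1 - v 0) * ∏ i : Fin 10, 1 / Real.sqrt (v i.succ * (1 - v i.succ) * (1 - (if (i : ℕ) < 6 then v 0 else 1 - v 0) * v i.succ))) r₅.domain → r₇.domain = {v | ∀ i, v i ∈ Set.Ioo (0:ℝ) 1} → Set.EqOn r₇.integrand (fun v => v 0 * (1 - v 0) * ∏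 i : Fin 10, 1 / Real.sqrt (v i.succ * (1 - v i.succ) * (1 - (if (i : ℕ) < 4 then v 0 else 1 - v 0) * v i.succ))) r₇.domain → (9 : ℤ) • Literature.NumberTheory.Transcendental.KZ.of r₃ - (30 : ℤ) • Literature.NumberTheory.Transcendental.KZ.of r₅ + (16 : ℤ) • Literature.NumberTheory.Transcendental.KZ.of r₇ ∈ Literature.NumberTheory.Transcendental.KZ.relations) →
    (∀ (k : ℕ), k ≤ 10 → ∀ (r r' : Literature.NumberTheory.Transcendental.KZ.IntegralRep 11), r.domain = {v | ∀ i, v i ∈ Set.Ioo (0:ℝ) 1} → Set.EqOn r.integrand (fun v => v 0 * (1 - v 0) * ∏ i : Fin 10, 1 / Real.sqrt (v i.succ * (1 - v i.succ) * (1 - (if (i : ℕ) < k then v 0 else 1 - v 0) * v i.succ))) r.domain → r'.domain = {v | ∀ i, v i ∈ Set.Ioo (0:ℝ) 1} → Set.EqOn r'.integrand (fun v => v 0 * (1 - v 0) * ∏ i : Fin 10, 1 / Real.sqrt (v i.succ * (1 - v i.succ) * (1 - (if (i : ℕ) < 10 - k then v 0 else 1 - v 0) * v i.succ))) r'.domain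 → Literature.NumberTheory.Transcendental.KZ.Equivalent r r') →
    (∀ (k : ℕ), k ≤ 10 → ∃ r : Literature.NumberTheory.Transcendental.KZ.IntegralRep 11, r.domain = {v | ∀ i, v i ∈ Set.Ioo (0:ℝ) 1} ∧ Set.EqOn r.integrand (fun v => v 0 * (1 - v 0) * ∏ i : Fin 10, 1 / Real.sqrt (v i.succ * (1 - v i.succ) * (1 - (if (i : ℕ) < k then v 0 else 1 - v 0) * v i.succ))) r.domain) →
    Summit.KontsevichZagierPeriods.KontsevichZagierPeriods.Theses.HeckeMultiplicityOne.DeltaRatioHecke := by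
  intro hT hM hR hE
  unfold Summit.KontsevichZagierPeriods.KontsevichZagierPeriods.Theses.HeckeMultiplicityOne.DeltaRatioHecke
  intro r₁ r₃ hd₁ he₁ hd₃ he₃
  -- the auxiliary representations R₅, R₇, R₉, R₁₁
  obtain ⟨r₅, hd₅, he₅⟩ := hE 6 (by norm_num)
  obtain ⟨r₇, hd₇, he₇⟩ := hE 4 (by norm_num)
  obtain ⟨r₉, hd₉, he₉⟩ := hE 2 (by norm_num)
  obtain ⟨r₁₁, hd₁₁, he₁₁⟩ := hE 0 (by norm_num)
  -- the two trace identities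
  have ρ₁ := hT r₁ r₃ r₅ r₇ r₉ r₁₁ hd₁ he₁ hd₃ he₃ hd₅ he₅ hd₇ he₇ hd₉ he₉ hd₁₁ he₁₁
  have ρ₂ := hM r₃ r₅ r₇ hd₃ he₃ hd₅ he₅ hd₇ he₇
  -- the three reflections (patterns re-spelled to match `LegendreReflection` at k = 10, 8, 6)
  have he₁' := eqOn_legendre_congr (c := fun v _ => v 0)
    (c' := fun v i => if (i : ℕ) < 10 then v 0 else 1 - v 0) (fun v i => by simp [Fin.is_lt i]) he₁
  have he₁₁' := eqOn_legendre_congr (c := fun v i => if (i : ℕ) < 0 then v 0 else 1 - v 0)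
    (c' := fun v i => if (i : ℕ) < 10 - 10 then v 0 else 1 - v 0) (fun v i => by simp) he₁₁
  have he₉' := eqOn_legendre_congr (c := fun v i => if (i : ℕ) < 2 then v 0 else 1 - v 0)
    (c' := fun v i => if (i : ℕ) < 10 - 8 then v 0 else 1 - v 0) (fun v i => by norm_num) he₉
  have he₇' := eqOn_legendre_congr (c := fun v i => if (i : ℕ) < 4 then v 0 else 1 - v 0)
    (c' := fun v i => if (i : ℕ) < 10 - 6 then v 0 else 1 - v 0) (fun v i => by norm_num) he₇
  have ρ₃ : of r₁ - of r₁₁ ∈ relations := hR 10 le_rfl r₁ r₁₁ hd₁ he₁' hd₁₁ he₁₁'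
  have ρ₄ : of r₃ - of r₉ ∈ relations := hR 8 (by norm_num) r₃ r₉ hd₃ he₃ hd₉ he₉'
  have ρ₅ : of r₅ - of r₇ ∈ relations := hR 6 (by norm_num) r₅ r₇ hd₅ he₅ hd₇ he₇'
  -- the Hecke projector: 1049 + 1024 = 2073 = 3 · 691
  have key : (3 : ℤ) • ((691 : ℤ) • of r₁ - (1620 : ℤ) • of r₃) =
      ((1049 : ℤ) • of r₁ + (180 : ℤ) • of r₃ - (3360 : ℤ) • of r₅ + (13440 : ℤ) • of r₇
          - (11520 : ℤ) • of r₉ + (1024 : ℤ) • of r₁₁)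
        + (720 : ℤ) • ((9 : ℤ) • of r₃ - (30 : ℤ) • of r₅ + (16 : ℤ) • of r₇)
        + (1024 : ℤ) • (of r₁ - of r₁₁) + (-11520 : ℤ) • (of r₃ - of r₉)
        + (24960 : ℤ) • (of r₅ - of r₇) := by
    module
  have h3 : (3 : ℤ) • ((691 : ℤ) • of r₁ - (1620 : ℤ) • of r₃) ∈ relations := by
    rw [key]
    exact relations.add_mem (relations.add_mem (relations.add_mem (relations.add_mem ρ₁
      (relations.zsmul_mem ρ₂ _)) (relations.zsmul_mem ρ₃ _)) (relations.zsmul_mem ρ₄ _))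
      (relations.zsmul_mem ρ₅ _)
  exact mem_relations_of_zsmul_mem (by norm_num) h3

/-- **By-product: the middle trace identity and the reflection give the sibling crux
`DeltaRatioStokes`** (`LegendreMiddleTrace → LegendreReflection → LegendreRepExists → DeltaRatioStokes`,
texts verbatim): `9·[R₃] − 14·[R₅] = ρ₂ + 16·([R₅] − [R₇])`, `R₇` from `LegendreRepExists`.
[cite: Manin1973, §§7–9] [cite: KontsevichZagier2001, §3.4] -/
theorem DeltaRatioStokes_of :
    (∀ (r₃ r₅ r₇ : Literature.NumberTheory.Transcendental.KZ.IntegralRep 11), r₃.domain = {v | ∀ i, v i ∈ Set.Ioo (0:ℝ) 1} → Set.EqOn r₃.integrand (fun v => v 0 * (1 - v 0) * ∏ i : Fin 10, 1 / Real.sqrt (v i.succ * (1 - v i.succ) * (1 - (if (i : ℕ) < 8 then v 0 else 1 - v 0) * v i.succ))) r₃.domain → r₅.domain = {v | ∀ i, v i ∈ Set.Ioo (0:ℝ) 1} → Set.EqOn r₅.integrand (fun v => v 0 * (1 - v 0) * ∏ i : Fin 10, 1 / Real.sqrt (v i.succ * (1 - v i.succ) * (1 - (if (i : ℕ) < 6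 then v 0 else 1 - v 0) * v i.succ))) r₅.domain → r₇.domain = {v | ∀ i, v i ∈ Set.Ioo (0:ℝ) 1} → Set.EqOn r₇.integrand (fun v => v 0 * (1 - v 0) * ∏ i : Fin 10, 1 / Real.sqrt (v i.succ * (1 - v i.succ) * (1 - (if (i : ℕ) < 4 then v 0 else 1 - v 0) * v i.succ))) r₇.domain → (9 : ℤ) • Literature.NumberTheory.Transcendental.KZ.of r₃ - (30 : ℤ) • Literature.NumberTheory.Transcendental.KZ.of r₅ + (16 : ℤ) • Literature.NumberTheory.Transcendental.KZ.of r₇ ∈ Literature.NumberTheory.Transcendental.KZ.relations) →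
    (∀ (k : ℕ), k ≤ 10 → ∀ (r r' : Literature.NumberTheory.Transcendental.KZ.IntegralRep 11), r.domain = {v | ∀ i, v i ∈ Set.Ioo (0:ℝ) 1} → Set.EqOn r.integrand (fun v => v 0 * (1 - v 0) * ∏ i : Fin 10, 1 / Real.sqrt (v i.succ * (1 - v i.succ) * (1 - (if (i : ℕ) < k then v 0 else 1 - v 0) * v i.succ))) r.domain → r'.domain = {v | ∀ i, v i ∈ Set.Ioo (0:ℝ) 1} → Set.EqOn r'.integrand (fun v => v 0 * (1 - v 0) * ∏ i : Fin 10, 1 / Real.sqrt (v i.succ * (1 - v i.succ) * (1 - (if (i : ℕ) < 10 - k then v 0 else 1 - v 0) * v i.succ))) r'.domain → Literature.NumberTheory.Transcendental.KZ.Equivalent r r') →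
    (∀ (k : ℕ), k ≤ 10 → ∃ r : Literature.NumberTheory.Transcendental.KZ.IntegralRep 11, r.domain = {v | ∀ i, v i ∈ Set.Ioo (0:ℝ) 1} ∧ Set.EqOn r.integrand (fun v => v 0 * (1 - v 0) * ∏ i : Fin 10, 1 / Real.sqrt (v i.succ * (1 - v i.succ) * (1 - (if (i : ℕ) < k then v 0 else 1 - v 0) * v i.succ))) r.domain) →
    Summit.KontsevichZagierPeriods.KontsevichZagierPeriods.Theses.HeckeMultiplicityOne.DeltaRatioStokes := by
  intro hM hR hE
  unfold Summit.KontsevichZagierPeriods.KontsevichZagierPeriods.Theses.HeckeMultiplicityOne.DeltaRatioStokes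
  intro r₃ r₅ hd₃ he₃ hd₅ he₅
  obtain ⟨r₇, hd₇, he₇⟩ := hE 4 (by norm_num)
  have ρ₂ := hM r₃ r₅ r₇ hd₃ he₃ hd₅ he₅ hd₇ he₇
  have he₇' := eqOn_legendre_congr (c := fun v i => if (i : ℕ) < 4 then v 0 else 1 - v 0)
    (c' := fun v i => if (i : ℕ) < 10 - 6 then v 0 else 1 - v 0) (fun v i => by norm_num) he₇
  have ρ₅ : of r₅ - of r₇ ∈ relations := hR 6 (by norm_num) r₅ r₇ hd₅ he₅ hd₇ he₇'
  have key : (9 : ℤ) • of r₃ - (14 : ℤ) • of r₅ =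
      ((9 : ℤ) • of r₃ - (30 : ℤ) • of r₅ + (16 : ℤ) • of r₇) + (16 : ℤ) • (of r₅ - of r₇) := by
    module
  rw [key]
  exact relations.add_mem ρ₂ (relations.zsmul_mem ρ₅ _)

/-- **Conversely, `DeltaRatioStokes` and the reflection give the middle trace identity**
(`DeltaRatioStokes → LegendreReflection → LegendreMiddleTrace`, texts verbatim):
`ρ₂ = (9·[R₃] − 14·[R₅]) − 16·([R₅] − [R₇])`. Modulo `LegendreReflection` the middle piece IS the
sibling crux: every relation among the middle periods `r₂, r₄, r₆` of `Δ` is a combination of Manin's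
`9 r₂ = 14 r₄` and `r₄ = r₆`. [cite: Manin1973, §§7–9] [cite: KontsevichZagier2001, §3.4] -/
theorem stub_middleTrace_of_deltaRatioStokes :
    Summit.KontsevichZagierPeriods.KontsevichZagierPeriods.Theses.HeckeMultiplicityOne.DeltaRatioStokes →
    (∀ (k : ℕ), k ≤ 10 → ∀ (r r' : Literature.NumberTheory.Transcendental.KZ.IntegralRep 11), r.domain = {v | ∀ i, v i ∈ Set.Ioo (0:ℝ) 1} → Set.EqOn r.integrand (fun v => v 0 * (1 - v 0) * ∏ i : Fin 10, 1 / Real.sqrt (v i.succ * (1 - v i.succ) * (1 - (if (i : ℕ) < k then v 0 else 1 - v 0) * v i.succ))) r.domain → r'.domain = {v | ∀ i, v i ∈ Set.Ioo (0:ℝ) 1} → Set.EqOn r'.integrand (fun v => v 0 * (1 - v 0) * ∏ i : Fin 10, 1 / Real.sqrt (v i.succ * (1 - v i.succ) * (1 - (if (i : ℕ) < 10 - k then v 0 else 1 - v 0) * v i.succ))) r'.domain → Literature.NumberTheory.Transcendental.KZ.Equivalent r r') →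
    ∀ (r₃ r₅ r₇ : Literature.NumberTheory.Transcendental.KZ.IntegralRep 11), r₃.domain = {v | ∀ i, v i ∈ Set.Ioo (0:ℝ) 1} → Set.EqOn r₃.integrand (fun v => v 0 * (1 - v 0) * ∏ i : Fin 10, 1 / Real.sqrt (v i.succ * (1 - v i.succ) * (1 - (if (i : ℕ) < 8 then v 0 else 1 - v 0) * v i.succ))) r₃.domain → r₅.domain = {v | ∀ i, v i ∈ Set.Ioo (0:ℝ) 1} → Set.EqOn r₅.integrand (fun v => v 0 * (1 - v 0) * ∏ i : Fin 10, 1 / Real.sqrt (v i.succ * (1 - v i.succ) * (1 - (if (i : ℕ) < 6 then v 0 else 1 - v 0) * v i.succ))) r₅.domain → r₇.domain = {v | ∀ i, v i ∈ Set.Ioo (0:ℝ) 1} → Set.EqOn r₇.integrand (fun v => v 0 * (1 - v 0) * ∏ i : Fin 10, 1 / Real.sqrt (v i.succ * (1 - v i.succ) * (1 - (if (i : ℕ) < 4 then v 0 else 1 - v 0) * v i.succ))) r₇.domain → (9 : ℤ) • Literature.NumberTheory.Transcendental.KZ.of r₃ - (30 : ℤ) • Literature.NumberTheory.Transcendental.KZ.of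 r₅ + (16 : ℤ) • Literature.NumberTheory.Transcendental.KZ.of r₇ ∈ Literature.NumberTheory.Transcendental.KZ.relations := by
  intro hS hR r₃ r₅ r₇ hd₃ he₃ hd₅ he₅ hd₇ he₇
  have ρ := hS r₃ r₅ hd₃ he₃ hd₅ he₅
  have he₇' := eqOn_legendre_congr (c := fun v i => if (i : ℕ) < 4 then v 0 else 1 - v 0)
    (c' := fun v i => if (i : ℕ) < 10 - 6 then v 0 else 1 - v 0) (fun v i => by norm_num) he₇
  have ρ₅ : of r₅ - of r₇ ∈ relations := hR 6 (by norm_num) r₅ r₇ hd₅ he₅ hd₇ he₇'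
  have key : (9 : ℤ) • of r₃ - (30 : ℤ) • of r₅ + (16 : ℤ) • of r₇ =
      ((9 : ℤ) • of r₃ - (14 : ℤ) • of r₅) - (16 : ℤ) • (of r₅ - of r₇) := by
    module
  rw [key]
  exact relations.sub_mem ρ (relations.zsmul_mem ρ₅ _)


/-- **The line closes the crux**: `DeltaRatioHecke` from the four stubs (kernel-checked composition
applied to the registered stubs). [cite: Manin1973, §§7–9] -/
theorem deltaRatioHecke_of_stubs :
    Summit.KontsevichZagierPeriods.KontsevichZagierPeriods.Theses.HeckeMultiplicityOne.DeltaRatioHecke :=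
  DeltaRatioHecke_of stub_heckeTrace stub_middleTrace stub_reflection stub_repExists

end Summit.KontsevichZagierPeriods.KontsevichZagierPeriods.Cruxes.DeltaRatioHecke.T2Traces

end
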